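import Literature.NumberTheory.LFunctions.WeilTwoPrimeMinorant
import HarnessLib

/-!
# A sharp tail level for two-prime minorant chains: the true minimum of `w₂₃` beyond `T`

The validity predicate `CellsOK₂₃ wL T cells` of a two-prime minorant chain
(`Literature.NumberTheory.LFunctions.WeilTwoPrimeMinorant`) carries the tail field
`level : ∀ t, T ≤ |t| → wL ≤ w₂₃ t`, and every deflated two-prime certificate consumes `CellsOK₂₃`
as a hypothesis (`WeilCert23.…_of_cellsOK`).  The integer checker `checkCells₂₃` proves the field
by ONE AMPLITUDE PER RIPPLE, `wL + √2 log 2 + 2 log 3/√3 ≤ Re ψ(1/4 + iT/2)`, i.e. it prices the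
tail at the level the two ripples would reach if they aligned exactly at `t = T`.  They do not:
`cos(t log 2)` and `cos(t log 3)` align only near `t = 2πk/log 2` with `k log 3/log 2` close to an
integer, so the true minimum of
`w₂₃(t) = Re ψ(1/4 + it/2) − √2 log 2 cos(t log 2) − (2 log 3/√3) cos(t log 3)` on `[T, ∞)` is
larger than the amplitude level (at `T = 120`: `2.096` against `1.8455`, i.e. `κ = 0.95` against
`0.70`; at `T = 218`: `2.63` against `2.44`).

This file proves the tail field from a KERNEL-CHECKED TAIL TABLE instead (our device, not in
Yoshida's paper): a grid `T = u₀ ≤ u₁ ≤ ⋯ ≤ u_n = T₂` (given as `T` and the list of the later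
points); on each cell `[u_k, u_{k+1}]` the weight is
bounded below by `Re ψ` at the left end point (monotone in `|t|`, certified series `wLoQ₂`) plus,
for each ripple, either `min` of the certified values `−c_n cos(u log n)` at the two end points —
valid when the cell provably contains no maximum of `cos(t log n)`, i.e. no multiple of `2π/log n`
(`tl_noPeak`, rational test against 20-digit bounds for `2π` and the engine's `log n` intervals;
`tl_cos_le_max`: inside one period `cos` takes its maximum at an end point) — or the amplitude
`−c_n`; beyond `T₂` the amplitude bound of `level_of_le₂₃` takes over.  Soundness:
`tl_level_of_tailCheck`; re-levelling a valid chain: `tl_cellsOK_relevel`,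
**`tl_cellsOK_of_tailCheck`** (same cells, same `T`, higher `wL`).  With the moment level-shift
identities (companion file) a certificate at the higher level reuses every landed moment fact of
the chain.  GroundBarta rung 4 (EvenWinsBeyondArch ≡ WeilParity ladder), prover A g11; the
enabling step for the windows beyond `(log 5)/2`, where the sliver loss `ℓ(3,5) = 1.066` must be
paid out of the complement level.  Everything here is proved; no data, no named facts.
-/

set_option linter.dupNamespace false

noncomputable section

namespace Summit.RiemannHypothesis.RiemannHypothesis.Theorems.EvenWinsBeyondArch

open Literature.NumberTheory.LFunctions
open Literature.Analysis.ValidatedNumerics.Numerics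
open Literature.Analysis.SpecialFunctions

/-! ## `cos` on an interval inside one period -/

/-- Inside one period `(2πm, 2π(m+1))` the cosine takes its maximum on `[θ₁, θ₂]` at an end
point (it decreases to `2πm + π` and increases after). [folklore] -/
theorem tl_cos_le_max {θ θ₁ θ₂ : ℝ} {m : ℤ} (hm₁ : 2 * Real.pi * m < θ₁)
    (hm₂ : θ₂ < 2 * Real.pi * (m + 1)) (h₁ : θ₁ ≤ θ) (h₂ : θ ≤ θ₂) :
    Real.cos θ ≤ max (Real.cos θ₁) (Real.cos θ₂) := by
  have key : ∀ x : ℝ, Real.cos x = -Real.cos (x - (m : ℝ) * (2 * Real.pi) - Real.pi) := by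
    intro x
    rw [Real.cos_sub_pi, Real.cos_sub_int_mul_two_pi]
    ring
  set z := θ - (m : ℝ) * (2 * Real.pi) - Real.pi with hz
  set z₁ := θ₁ - (m : ℝ) * (2 * Real.pi) - Real.pi with hz₁
  set z₂ := θ₂ - (m : ℝ) * (2 * Real.pi) - Real.pi with hz₂
  have hlo : -Real.pi < z₁ := by rw [hz₁]; linarith
  have hhi : z₂ < Real.pi := by rw [hz₂]; linarith
  have hzz₁ : z₁ ≤ z := by rw [hz, hz₁]; linarith
  have hzz₂ : z ≤ z₂ := by rw [hz, hz₂]; linarith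
  rw [key θ, key θ₁, key θ₂]
  have habs : |z| ≤ max |z₁| |z₂| := by
    rcases le_or_gt 0 z with h0 | h0
    · rw [abs_of_nonneg h0]
      exact le_trans (hzz₂.trans (le_abs_self z₂)) (le_max_right _ _)
    · rw [abs_of_neg h0]
      exact le_trans (le_trans (by linarith) (neg_le_abs z₁)) (le_max_left _ _)
  have hw : max |z₁| |z₂| ≤ Real.pi :=
    max_le (abs_le.2 ⟨by linarith, by linarith⟩) (abs_le.2 ⟨by linarith, by linarith⟩)
  have hc : Real.cos (max |z₁| |z₂|) ≤ Real.cos z := by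
    rw [← Real.cos_abs z]
    exact Real.cos_le_cos_of_nonneg_of_le_pi (abs_nonneg z) hw habs
  rcases le_total |z₁| |z₂| with h12 | h12
  · rw [max_eq_right h12, Real.cos_abs] at hc
    exact le_trans (by linarith) (le_max_right _ _)
  · rw [max_eq_left h12, Real.cos_abs] at hc
    exact le_trans (by linarith) (le_max_left _ _)

/-- A 20-digit rational below `2π`. [folklore] -/
def tl_twoPiLo : ℚ := 628318530717958647692 / 100000000000000000000

/-- A 20-digit rational above `2π`. [folklore] -/
def tl_twoPiHi : ℚ := 628318530717958647694 / 100000000000000000000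

/-- `tl_twoPiLo < 2π`. [folklore] -/
theorem tl_twoPiLo_lt : ((tl_twoPiLo : ℚ) : ℝ) < 2 * Real.pi := by
  have h := Real.pi_gt_d20
  have e : ((tl_twoPiLo : ℚ) : ℝ) = 2 * 3.14159265358979323846 := by
    unfold tl_twoPiLo; push_cast; norm_num
  rw [e]; linarith

/-- `2π < tl_twoPiHi`. [folklore] -/
theorem tl_lt_twoPiHi : 2 * Real.pi < ((tl_twoPiHi : ℚ) : ℝ) := by
  have h := Real.pi_lt_d20
  have e : ((tl_twoPiHi : ℚ) : ℝ) = 2 * 3.14159265358979323847 := by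
    unfold tl_twoPiHi; push_cast; norm_num
  rw [e]; linarith

/-- **Peak-free test.** For a frequency `ℓ ∈ [Llo, Lhi]` and a cell `[u, v]`: with
`m = ⌊u Llo/2π⁺⌋`, the cell `[uℓ, vℓ]` lies inside the period `(2πm, 2π(m+1))` if
`2π⁺ m < u Llo` and `v Lhi < 2π⁻ (m+1)` (`m ≥ 0`). Decidable over `ℚ`. [folklore] -/
def tl_noPeak (Llo Lhi u v : ℚ) : Bool :=
  let m : ℤ := ⌊u * Llo / tl_twoPiHi⌋
  decide (0 ≤ m) && decide (tl_twoPiHi * m < u * Llo) && decide (v * Lhi < tl_twoPiLo * (m + 1))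

/-- Soundness of the peak-free test: `cos(tℓ) ≤ max (cos(uℓ)) (cos(vℓ))` on the cell. [folklore] -/
theorem tl_cos_le_max_of_noPeak {Llo Lhi u v : ℚ} {ℓ : ℝ} (h : tl_noPeak Llo Lhi u v = true)
    (hℓ0 : 0 ≤ ℓ) (hℓlo : ((Llo : ℚ) : ℝ) ≤ ℓ) (hℓhi : ℓ ≤ ((Lhi : ℚ) : ℝ)) (hu : 0 ≤ u)
    {t : ℝ} (hut : ((u : ℚ) : ℝ) ≤ t) (htv : t ≤ ((v : ℚ) : ℝ)) :
    Real.cos (t * ℓ) ≤ max (Real.cos ((u : ℝ) * ℓ)) (Real.cos ((v : ℝ) * ℓ)) := by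
  unfold tl_noPeak at h
  simp only [Bool.and_eq_true, decide_eq_true_eq] at h
  obtain ⟨⟨hm0, hm1⟩, hm2⟩ := h
  set m : ℤ := ⌊u * Llo / tl_twoPiHi⌋ with hm
  have hu' : (0 : ℝ) ≤ u := by exact_mod_cast hu
  have hv' : (0 : ℝ) ≤ v := le_trans hu' (hut.trans htv)
  have hm0' : (0 : ℝ) ≤ (m : ℝ) := by exact_mod_cast hm0
  have hm1' : ((tl_twoPiHi : ℚ) : ℝ) * (m : ℝ) < (u : ℝ) * (Llo : ℝ) := by exact_mod_cast hm1
  have hm2' : ((v : ℚ) : ℝ) * (Lhi : ℝ) < ((tl_twoPiLo : ℚ) : ℝ) * ((m : ℝ) + 1) := by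
    exact_mod_cast hm2
  have h2pi_lo := tl_twoPiLo_lt
  have h2pi_hi := tl_lt_twoPiHi
  have hθ₁ : 2 * Real.pi * (m : ℝ) < (u : ℝ) * ℓ := by
    calc 2 * Real.pi * (m : ℝ) ≤ ((tl_twoPiHi : ℚ) : ℝ) * (m : ℝ) :=
          mul_le_mul_of_nonneg_right h2pi_hi.le hm0'
      _ < (u : ℝ) * (Llo : ℝ) := hm1'
      _ ≤ (u : ℝ) * ℓ := mul_le_mul_of_nonneg_left hℓlo hu'
  have hθ₂ : (v : ℝ) * ℓ < 2 * Real.pi * ((m : ℝ) + 1) := by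
    calc (v : ℝ) * ℓ ≤ (v : ℝ) * (Lhi : ℝ) := mul_le_mul_of_nonneg_left hℓhi hv'
      _ < ((tl_twoPiLo : ℚ) : ℝ) * ((m : ℝ) + 1) := hm2'
      _ ≤ 2 * Real.pi * ((m : ℝ) + 1) := mul_le_mul_of_nonneg_right h2pi_lo.le (by linarith)
  exact tl_cos_le_max hθ₁ hθ₂ (mul_le_mul_of_nonneg_right hut hℓ0)
    (mul_le_mul_of_nonneg_right htv hℓ0)

/-! ## Certified lower bounds of the two ripples on a cell -/

/-- Lower bound of `α₂(t) = −√2 log 2 · cos(t log 2)` on `[u, v]`: `min` of the engine values at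
the end points when the cell is peak-free, else the amplitude `−c₀⁺`. [folklore] -/
def tl_rip2Lo (u v : ℚ) : ℚ :=
  if tl_noPeak logTwoFI.loQ logTwoFI.hiQ u v then min (alphaLoQ u) (alphaLoQ v) else -cZeroFI.hiQ

/-- Lower bound of `α₃(t) = −(2 log 3/√3) · cos(t log 3)` on `[u, v]`. [folklore] -/
def tl_rip3Lo (u v : ℚ) : ℚ :=
  if tl_noPeak logThreeFI.loQ logThreeFI.hiQ u v then min (alpha3LoQ u) (alpha3LoQ v)
  else -cThreeFI.hiQ

/-- Soundness of `tl_rip2Lo`. [folklore] -/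
theorem tl_rip2Lo_le {u v : ℚ} (hu : 0 ≤ u) {t : ℝ} (hut : ((u : ℚ) : ℝ) ≤ t)
    (htv : t ≤ ((v : ℚ) : ℝ)) :
    ((tl_rip2Lo u v : ℚ) : ℝ) ≤ -(Real.sqrt 2 * Real.log 2 * Real.cos (t * Real.log 2)) := by
  have hc0 : 0 ≤ Real.sqrt 2 * Real.log 2 := by positivity
  unfold tl_rip2Lo
  split_ifs with h
  · have hℓ := mem_logTwoFI
    have hc := tl_cos_le_max_of_noPeak h (Real.log_nonneg (by norm_num)) (FI.loQ_le hℓ)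
      (FI.le_hiQ hℓ) hu hut htv
    have hau := alphaLoQ_le u
    have hav := alphaLoQ_le v
    push_cast
    rcases le_total (Real.cos ((u : ℝ) * Real.log 2)) (Real.cos ((v : ℝ) * Real.log 2)) with
      huv | huv
    · rw [max_eq_right huv] at hc
      have : Real.sqrt 2 * Real.log 2 * Real.cos (t * Real.log 2) ≤
          Real.sqrt 2 * Real.log 2 * Real.cos ((v : ℝ) * Real.log 2) :=
        mul_le_mul_of_nonneg_left hc hc0
      exact le_trans (min_le_right _ _) (by linarith)
    · rw [max_eq_left huv] at hc
      have : Real.sqrt 2 * Real.log 2 * Real.cos (t * Real.log 2) ≤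
          Real.sqrt 2 * Real.log 2 * Real.cos ((u : ℝ) * Real.log 2) :=
        mul_le_mul_of_nonneg_left hc hc0
      exact le_trans (min_le_left _ _) (by linarith)
  · have h1 : Real.sqrt 2 * Real.log 2 * Real.cos (t * Real.log 2) ≤ Real.sqrt 2 * Real.log 2 :=
      mul_le_of_le_one_right hc0 (Real.cos_le_one _)
    have h2 : Real.sqrt 2 * Real.log 2 ≤ ((cZeroFI.hiQ : ℚ) : ℝ) := FI.le_hiQ mem_cZeroFI
    push_cast
    linarith

/-- Soundness of `tl_rip3Lo`. [folklore] -/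
theorem tl_rip3Lo_le {u v : ℚ} (hu : 0 ≤ u) {t : ℝ} (hut : ((u : ℚ) : ℝ) ≤ t)
    (htv : t ≤ ((v : ℚ) : ℝ)) :
    ((tl_rip3Lo u v : ℚ) : ℝ) ≤ -(2 * Real.log 3 / Real.sqrt 3 * Real.cos (t * Real.log 3)) := by
  have hc0 : 0 ≤ 2 * Real.log 3 / Real.sqrt 3 := by positivity
  unfold tl_rip3Lo
  split_ifs with h
  · have hℓ := mem_logThreeFI
    have hc := tl_cos_le_max_of_noPeak h (Real.log_nonneg (by norm_num)) (FI.loQ_le hℓ)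
      (FI.le_hiQ hℓ) hu hut htv
    have hau := alpha3LoQ_le u
    have hav := alpha3LoQ_le v
    push_cast
    rcases le_total (Real.cos ((u : ℝ) * Real.log 3)) (Real.cos ((v : ℝ) * Real.log 3)) with
      huv | huv
    · rw [max_eq_right huv] at hc
      have : 2 * Real.log 3 / Real.sqrt 3 * Real.cos (t * Real.log 3) ≤
          2 * Real.log 3 / Real.sqrt 3 * Real.cos ((v : ℝ) * Real.log 3) :=
        mul_le_mul_of_nonneg_left hc hc0
      exact le_trans (min_le_right _ _) (by linarith)
    · rw [max_eq_left huv] at hc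
      have : 2 * Real.log 3 / Real.sqrt 3 * Real.cos (t * Real.log 3) ≤
          2 * Real.log 3 / Real.sqrt 3 * Real.cos ((u : ℝ) * Real.log 3) :=
        mul_le_mul_of_nonneg_left hc hc0
      exact le_trans (min_le_left _ _) (by linarith)
  · have h1 : 2 * Real.log 3 / Real.sqrt 3 * Real.cos (t * Real.log 3) ≤
        2 * Real.log 3 / Real.sqrt 3 := mul_le_of_le_one_right hc0 (Real.cos_le_one _)
    have h2 : 2 * Real.log 3 / Real.sqrt 3 ≤ ((cThreeFI.hiQ : ℚ) : ℝ) := FI.le_hiQ mem_cThreeFI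
    push_cast
    linarith

/-! ## The cell bound and the tail table -/

/-- Certified lower bound of `w₂₃` on the cell `[u, v]`: `Re ψ` at the left end point (`M` series
terms, `p` bits) plus the two ripple bounds. [folklore] -/
def tl_cellLo (p M : ℕ) (u v : ℚ) : ℚ := wLoQ₂ p u M + tl_rip2Lo u v + tl_rip3Lo u v

/-- The weight is even. [folklore] -/
theorem tl_weilTwoPrimeWeight_abs (t : ℝ) : weilTwoPrimeWeight |t| = weilTwoPrimeWeight t := by
  unfold weilTwoPrimeWeight
  rw [reDigammaQuarter_abs t, cos_abs_mul t (Real.log 2), cos_abs_mul t (Real.log 3)]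

/-- **Soundness of the cell bound**: `tl_cellLo ≤ w₂₃(t)` for `t ∈ [u, v]`, `u ≥ 0`. [folklore] -/
theorem tl_cellLo_le {p M : ℕ} {u v : ℚ} (hu : 0 ≤ u) {t : ℝ} (hut : ((u : ℚ) : ℝ) ≤ t)
    (htv : t ≤ ((v : ℚ) : ℝ)) : ((tl_cellLo p M u v : ℚ) : ℝ) ≤ weilTwoPrimeWeight t := by
  have hu' : (0 : ℝ) ≤ u := by exact_mod_cast hu
  have h1 := wLoQ₂_le p u M
  have h2 : reDigammaQuarter (u : ℝ) ≤ reDigammaQuarter t :=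
    reDigammaQuarter_mono (by rw [abs_of_nonneg hu', abs_of_nonneg (hu'.trans hut)]; exact hut)
  have h3 := tl_rip2Lo_le hu hut htv
  have h4 := tl_rip3Lo_le hu hut htv
  unfold tl_cellLo weilTwoPrimeWeight
  push_cast
  linarith

/-- The cell tests along a grid: starting from the point `u`, for every next point `v` the cell
`[u, v]` is ordered and passes `wL ≤ tl_cellLo`. Structural recursion on the list of points.
[folklore] -/
def tl_tailCellsFrom (p M : ℕ) (wL : ℚ) : ℚ → List ℚ → Bool
  | _, [] => true
  | u, v :: rest =>
    decide (u ≤ v) && decide (wL ≤ tl_cellLo p M u v) && tl_tailCellsFrom p M wL v rest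

/-- The last point of the grid `u, rest`. [folklore] -/
def tl_lastFrom : ℚ → List ℚ → ℚ
  | u, [] => u
  | _, v :: rest => tl_lastFrom v rest

/-- Tail covers (`wL ≤ w₂₃` on `[a, b)` and on `[b, c)`) compose along consecutive intervals.
[folklore] -/
theorem tl_tailCovers_trans {wL a b c : ℚ}
    (h₁ : (∀ t : ℝ, ((a : ℚ) : ℝ) ≤ t → t < ((b : ℚ) : ℝ) → ((wL : ℚ) : ℝ) ≤ weilTwoPrimeWeight t))
    (h₂ : ∀ t : ℝ, ((b : ℚ) : ℝ) ≤ t → t < ((c : ℚ) : ℝ) → ((wL : ℚ) : ℝ) ≤ weilTwoPrimeWeight t) :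
    ∀ t : ℝ, ((a : ℚ) : ℝ) ≤ t → t < ((c : ℚ) : ℝ) → ((wL : ℚ) : ℝ) ≤ weilTwoPrimeWeight t :=
  fun t hat htc ↦ by
  rcases lt_or_ge t ((b : ℚ) : ℝ) with htb | htb
  · exact h₁ t hat htb
  · exact h₂ t htb htc

/-- Soundness of the cell tests: the grid `s, rest` covers `[s, e)` where `e` is its last point
(one kernel `decide` per chunk of cells; chunks compose by `tl_tailCovers_trans`). [folklore] -/
theorem tl_tailCellsFrom_sound {p M : ℕ} {wL : ℚ} :
    ∀ (rest : List ℚ) (s : ℚ), tl_tailCellsFrom p M wL s rest = true → 0 ≤ s →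
      ∀ t : ℝ, ((s : ℚ) : ℝ) ≤ t → t < ((tl_lastFrom s rest : ℚ) : ℝ) →
        ((wL : ℚ) : ℝ) ≤ weilTwoPrimeWeight t
  | [], s, _, _, t, hst, hte => by
    simp only [tl_lastFrom] at hte
    exact absurd hst (not_le.2 hte)
  | v :: rest, s, h, hs, t, hst, hte => by
    simp only [tl_tailCellsFrom, Bool.and_eq_true, decide_eq_true_eq] at h
    obtain ⟨⟨hsv, hcell⟩, hrest⟩ := h
    simp only [tl_lastFrom] at hte
    rcases le_or_gt t ((v : ℚ) : ℝ) with htv | htv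
    · exact le_trans (by exact_mod_cast hcell) (tl_cellLo_le hs hst htv)
    · exact tl_tailCellsFrom_sound rest v hrest (le_trans hs hsv) t htv.le hte

/-- Chunk form with the end point named: if the cells from `s` pass and the grid ends at `e`,
the tail is covered on `[s, e)`. [folklore] -/
theorem tl_tailCovers_of_cells {p M : ℕ} {wL s e : ℚ} {rest : List ℚ}
    (h : tl_tailCellsFrom p M wL s rest = true) (he : tl_lastFrom s rest = e) (hs : 0 ≤ s) :
    (∀ t : ℝ, ((s : ℚ) : ℝ) ≤ t → t < ((e : ℚ) : ℝ) → ((wL : ℚ) : ℝ) ≤ weilTwoPrimeWeight t) :=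
  he ▸ tl_tailCellsFrom_sound rest s h hs

/-- **From a cover of `[T, T₂)` and the amplitude bound at `T₂` to the tail field**:
`wL ≤ w₂₃(t)` for every `|t| ≥ T`. [folklore] -/
theorem tl_level_of_covers {p M : ℕ} {wL T T₂ : ℚ} (hT₂ : 0 ≤ T₂)
    (hcov : ∀ t : ℝ, ((T : ℚ) : ℝ) ≤ t → t < ((T₂ : ℚ) : ℝ) →
      ((wL : ℚ) : ℝ) ≤ weilTwoPrimeWeight t)
    (hamp : wL + cZeroFI.hiQ + cThreeFI.hiQ ≤ wLoQ₂ p T₂ M) :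
    ∀ t : ℝ, ((T : ℚ) : ℝ) ≤ |t| → ((wL : ℚ) : ℝ) ≤ weilTwoPrimeWeight t := by
  intro t ht
  rw [← tl_weilTwoPrimeWeight_abs t]
  rcases le_or_gt (((T₂ : ℚ) : ℝ)) |t| with hT₂' | hT₂'
  · have h1 := wLoQ₂_le p T₂ M
    have h2 : Real.sqrt 2 * Real.log 2 ≤ ((cZeroFI.hiQ : ℚ) : ℝ) := FI.le_hiQ mem_cZeroFI
    have h3 : 2 * Real.log 3 / Real.sqrt 3 ≤ ((cThreeFI.hiQ : ℚ) : ℝ) := FI.le_hiQ mem_cThreeFI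
    have hamp' : ((wL : ℚ) : ℝ) + cZeroFI.hiQ + cThreeFI.hiQ ≤ wLoQ₂ p T₂ M := by
      exact_mod_cast hamp
    refine level_of_le₂₃ hT₂ ?_ (by rwa [abs_abs])
    linarith
  · exact hcov |t| ht hT₂'

/-- **The tail table check** (single-chunk form): `0 ≤ T`, the grid `T, rest` ends at `T₂ ≥ 0`,
every cell passes, and beyond `T₂` the amplitude bound `wL + c₀⁺ + c₃⁺ ≤ Re ψ(1/4 + iT₂/2)⁻`
holds. [folklore] -/
def tl_tailCheck (p M : ℕ) (wL T T₂ : ℚ) (rest : List ℚ) : Bool :=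
  decide (0 ≤ T) && decide (0 ≤ T₂) && decide (tl_lastFrom T rest = T₂) &&
    tl_tailCellsFrom p M wL T rest && decide (wL + cZeroFI.hiQ + cThreeFI.hiQ ≤ wLoQ₂ p T₂ M)

/-- **Soundness of the tail table**: `wL ≤ w₂₃(t)` for every `|t| ≥ T`. [folklore] -/
theorem tl_level_of_tailCheck {p M : ℕ} {wL T T₂ : ℚ} {rest : List ℚ}
    (h : tl_tailCheck p M wL T T₂ rest = true) :
    ∀ t : ℝ, ((T : ℚ) : ℝ) ≤ |t| → ((wL : ℚ) : ℝ) ≤ weilTwoPrimeWeight t := by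
  unfold tl_tailCheck at h
  simp only [Bool.and_eq_true, decide_eq_true_eq] at h
  obtain ⟨⟨⟨⟨hT0, hT₂0⟩, hlast⟩, hcells⟩, hamp⟩ := h
  exact tl_level_of_covers hT₂0 (tl_tailCovers_of_cells hcells hlast hT0) hamp

/-! ## Re-levelling a valid chain -/

/-- A valid chain stays valid at any level whose tail bound holds (cells and chain are unchanged;
only the tail field depends on the level). [folklore] -/
theorem tl_cellsOK_relevel {wL wL' T : ℚ} {cells : List TPDCell} (h : CellsOK₂₃ wL T cells)
    (hl : ∀ t : ℝ, ((T : ℚ) : ℝ) ≤ |t| → ((wL' : ℚ) : ℝ) ≤ weilTwoPrimeWeight t) :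
    CellsOK₂₃ wL' T cells :=
  ⟨h.chain, h.valid, hl⟩

/-- **A valid chain re-levelled by a tail table.** If the chain `cells` is valid on `[0, T]` at
some level and the tail table certifies `wL' ≤ w₂₃` on `[T, ∞)`, the chain is valid at level
`wL'`. [folklore] -/
theorem tl_cellsOK_of_tailCheck {wL wL' T T₂ : ℚ} {cells : List TPDCell} {p M : ℕ}
    {rest : List ℚ} (h : CellsOK₂₃ wL T cells) (ht : tl_tailCheck p M wL' T T₂ rest = true) :
    CellsOK₂₃ wL' T cells :=
  tl_cellsOK_relevel h (tl_level_of_tailCheck ht)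

/-- **A valid chain re-levelled by chunked tail covers**: the cover of `[T, T₂)` (composed from
kernel-checked chunks by `tl_tailCovers_trans`) and the amplitude bound at `T₂` give the chain at
level `wL'`. [folklore] -/
theorem tl_cellsOK_of_covers {wL wL' T T₂ : ℚ} {cells : List TPDCell} {p M : ℕ}
    (h : CellsOK₂₃ wL T cells) (hT₂ : 0 ≤ T₂)
    (hcov : ∀ t : ℝ, ((T : ℚ) : ℝ) ≤ t → t < ((T₂ : ℚ) : ℝ) →
      ((wL' : ℚ) : ℝ) ≤ weilTwoPrimeWeight t)
    (hamp : wL' + cZeroFI.hiQ + cThreeFI.hiQ ≤ wLoQ₂ p T₂ M) : CellsOK₂₃ wL' T cells :=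
  tl_cellsOK_relevel h (tl_level_of_covers hT₂ hcov hamp)

end Summit.RiemannHypothesis.RiemannHypothesis.Theorems.EvenWinsBeyondArch
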